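import Literature.Computability.Complexity.PVStrings
import Literature.Computability.Complexity.CNF
import HarnessLib

/-!
# The gap machine in Cobham's class, I: parsing the code of a CNF

The input of the gap machine (`GapAssembly.GapMachine`) is the code `encodingCNF.encode φ` of a CNF
(`listBool` of `listBool` of `pairBool natBool boolBool`).  On the string number
`N = sn (encodingCNF.encode φ)` the following functions of Cobham's class read off the formula
(`PVStrings.lean`: strided virtual strings):

* `pM N` — the number `m` of clauses; `pCl N j` — where the item of clause `j` starts (its code is read
  at stride `2`); `pK N j` — the number of literals of clause `j`; `pLit N j i` — where literal `i` of
  clause `j` starts (its code is read at stride `4`); `pVar N j i`, `pPol N j i` — its variable and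
  polarity;
* **`parse_correct`** — on `sn (encode φ)` these are `φ.length`, `|φ[j]|`, `(φ[j][i]).1`,
  `(φ[j][i]).2`;
* `pv_pM`, `pv_pCl`, `pv_pK`, `pv_pLit`, `pv_pVar`, `pv_pPol` — membership in Cobham's class.

## References

* S. Arora, B. Barak, *Computational Complexity: A Modern Approach*, CUP 2009, §0.1, §2.3 (codes of CNFs).
-/

namespace Literature.Computability.Complexity

open _root_.Computability Literature.Analysis.FunctionSpaces

namespace GapPV

open StrNum

/-! ### The code of a CNF, unfolded -/

/-- The code of a literal. [cite: AroraBarakCC2009, §2.3] -/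
theorem encode_literal (l : Literal ℕ) : encodingLiteral.encode l = boolPair (encodeNat l.1) [l.2] := rfl

/-- The code of a clause. [cite: AroraBarakCC2009, §2.3] -/
theorem encode_clause (c : Clause ℕ) :
    encodingClause.encode c = boolPair (List.replicate c.length true) (c.foldr (fun l acc => boolPair (encodingLiteral.encode l) acc) []) := by
  show boolPair (unaryEncodeNat c.length) _ = _
  rw [unaryEncodeNat_eq_replicate]

/-- The code of a CNF. [cite: AroraBarakCC2009, §2.3] -/
theorem encode_cnf (φ : CNF ℕ) :
    encodingCNF.encode φ = boolPair (List.replicate φ.length true) (φ.foldr (fun c acc => boolPair (encodingClause.encode c) acc) []) := by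
  show boolPair (unaryEncodeNat φ.length) _ = _
  rw [unaryEncodeNat_eq_replicate]

/-- A `foldr boolPair` of codes is a `body` of the codes. [folklore] -/
theorem foldr_codes_eq_body {α : Type} (e : α → List Bool) (L : List α) (d : α) :
    L.foldr (fun a acc => boolPair (e a) acc) [] = body (fun i => e (L.getD i d)) 0 L.length := by
  have h := foldr_eq_body (L.map e) 0
  rw [List.drop_zero, List.length_map, Nat.sub_zero, List.foldr_map] at h
  rw [h]
  -- the bodies agree below `L.length`
  have key : ∀ (t k : ℕ), t + k ≤ L.length → body (fun i => (L.map e).getD i []) t k = body (fun i => e (L.getD i d)) t k := by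
    intro t k
    induction k generalizing t with
    | zero => intro _; rfl
    | succ k ih =>
      intro htk
      rw [body, body, ih (t + 1) (by omega)]
      congr 1
      rw [List.getD_eq_getElem?_getD, List.getD_eq_getElem?_getD, List.getElem?_map, List.getElem?_eq_getElem (by omega)]
      rfl
  exact key 0 L.length (by omega)

/-! ### The parser -/

/-- The number of clauses. [cite: AroraBarakCC2009, §2.3] -/
def pM (N : ℕ) : ℕ := vEnd N 0 1

/-- The start of the body of clause items. [folklore] -/
def pBody (N : ℕ) : ℕ := vRest N 0 1

/-- The start of the item of clause `j` (clocked: `j ↦ min j |N|`). [folklore] -/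
def pCl (N j : ℕ) : ℕ := vItem N (pBody N) 1 (min j N.size)

/-- The number of literals of clause `j`. [folklore] -/
def pK (N j : ℕ) : ℕ := vEnd N (pCl N j) 2

/-- The start of the body of literal items of clause `j`. [folklore] -/
def pLits (N j : ℕ) : ℕ := vRest N (pCl N j) 2

/-- The start of the item of literal `i` of clause `j`. [folklore] -/
def pLit (N j i : ℕ) : ℕ := vItem N (pLits N j) 2 (min i N.size)

/-- The variable of literal `i` of clause `j`. [folklore] -/
def pVar (N j i : ℕ) : ℕ := vVal N (pLit N j i) 4

/-- The polarity of literal `i` of clause `j` (as `0/1`). [folklore] -/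
def pPol (N j i : ℕ) : ℕ := (Nat.testBit N (vRest N (pLit N j i) 4)).toNat

/-! ### Membership in Cobham's class -/

/-- `pM` is in Cobham's class. [cite: Cobham1965] -/
theorem pv_pM : PV₁ pM := pv_vEnd.comp (IsPVDefinable.proj 0) (IsPVDefinable.const 0) (IsPVDefinable.const 1)

/-- `pBody` is in Cobham's class. [cite: Cobham1965] -/
theorem pv_pBody : PV₁ pBody := pv_vRest.comp (IsPVDefinable.proj 0) (IsPVDefinable.const 0) (IsPVDefinable.const 1)

/-- `pCl` is in Cobham's class. [cite: Cobham1965] -/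
theorem pv_pCl : PV₂ pCl :=
  pv_vItem.comp (IsPVDefinable.proj 0) (pv_pBody.comp (IsPVDefinable.proj 0)) (IsPVDefinable.const 1) (IsPVDefinable.proj 1)

/-- `pK` is in Cobham's class. [cite: Cobham1965] -/
theorem pv_pK : PV₂ pK := pv_vEnd.comp (IsPVDefinable.proj 0) (pv_pCl.comp (IsPVDefinable.proj 0) (IsPVDefinable.proj 1)) (IsPVDefinable.const 2)

/-- `pLits` is in Cobham's class. [cite: Cobham1965] -/
theorem pv_pLits : PV₂ pLits := pv_vRest.comp (IsPVDefinable.proj 0) (pv_pCl.comp (IsPVDefinable.proj 0) (IsPVDefinable.proj 1)) (IsPVDefinable.const 2)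

/-- `pLit` is in Cobham's class. [cite: Cobham1965] -/
theorem pv_pLit : PV₃ pLit :=
  pv_vItem.comp (IsPVDefinable.proj 0) (pv_pLits.comp (IsPVDefinable.proj 0) (IsPVDefinable.proj 1)) (IsPVDefinable.const 2) (IsPVDefinable.proj 2)

/-- `pVar` is in Cobham's class. [cite: Cobham1965] -/
theorem pv_pVar : PV₃ pVar :=
  pv_vVal.comp (IsPVDefinable.proj 0) (pv_pLit.comp (IsPVDefinable.proj 0) (IsPVDefinable.proj 1) (IsPVDefinable.proj 2)) (IsPVDefinable.const 4)

/-- `pPol` is in Cobham's class. [cite: Cobham1965] -/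
theorem pv_pPol : PV₃ pPol :=
  pv_tb.comp (IsPVDefinable.proj 0) (pv_vRest.comp (IsPVDefinable.proj 0)
    (pv_pLit.comp (IsPVDefinable.proj 0) (IsPVDefinable.proj 1) (IsPVDefinable.proj 2)) (IsPVDefinable.const 4))

/-! ### Correctness on codes of CNFs -/

section Correct

variable (φ : CNF ℕ)

/-- The code of `φ`, as read from the start. [folklore] -/
theorem reads_code : Reads (encodingCNF.encode φ) 0 1
    (boolPair (List.replicate φ.length true) (body (fun j => encodingClause.encode (φ.getD j [])) 0 φ.length)) := by
  have h := reads_self (encodingCNF.encode φ)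
  conv at h => arg 4; rw [encode_cnf, foldr_codes_eq_body encodingClause.encode φ []]
  exact h

/-- **`pM` reads the number of clauses.** [cite: AroraBarakCC2009, §2.3] -/
theorem pM_eq : pM (sn (encodingCNF.encode φ)) = φ.length := by
  unfold pM; rw [vEnd_eq one_pos (reads_code φ), List.length_replicate]

/-- `m ≤ |N|`. [folklore] -/
theorem length_le_size : φ.length ≤ (sn (encodingCNF.encode φ)).size := by rw [← pM_eq φ]; exact vEnd_le _ _ _

/-- The item of clause `j < m` is read at `(pCl, 1)` with its code at stride `2`. [folklore] -/
theorem reads_clause {j : ℕ} (hj : j < φ.length) :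
    Reads (encodingCNF.encode φ) (pCl (sn (encodingCNF.encode φ)) j) 2 (encodingClause.encode (φ[j])) := by
  have hb := reads_vRest one_pos (reads_code φ)
  have h := reads_item_code one_pos hb hj
  unfold pCl pBody
  rw [min_eq_left (hj.le.trans (length_le_size φ))]
  rw [List.getD_eq_getElem?_getD, List.getElem?_eq_getElem hj] at h
  simpa using h

/-- The clause code, unfolded for reading. [folklore] -/
theorem reads_clause' {j : ℕ} (hj : j < φ.length) :
    Reads (encodingCNF.encode φ) (pCl (sn (encodingCNF.encode φ)) j) 2
      (boolPair (List.replicate (φ[j]).length true) (body (fun i => encodingLiteral.encode ((φ[j]).getD i (0, false))) 0 (φ[j]).length)) := by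
  have h := reads_clause φ hj
  rw [encode_clause, foldr_codes_eq_body encodingLiteral.encode (φ[j]) (0, false)] at h
  exact h

/-- **`pK` reads the clause lengths.** [cite: AroraBarakCC2009, §2.3] -/
theorem pK_eq {j : ℕ} (hj : j < φ.length) : pK (sn (encodingCNF.encode φ)) j = (φ[j]).length := by
  unfold pK; rw [vEnd_eq two_pos (reads_clause' φ hj), List.length_replicate]

/-- `|φ[j]| ≤ |N|`. [folklore] -/
theorem clause_length_le_size {j : ℕ} (hj : j < φ.length) : (φ[j]).length ≤ (sn (encodingCNF.encode φ)).size := by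
  rw [← pK_eq φ hj]; exact vEnd_le _ _ _

/-- The code of literal `i` of clause `j` is read at `(pLit, 4)`. [folklore] -/
theorem reads_literal {j : ℕ} (hj : j < φ.length) {i : ℕ} (hi : i < (φ[j]).length) :
    Reads (encodingCNF.encode φ) (pLit (sn (encodingCNF.encode φ)) j i) 4 (boolPair (encodeNat ((φ[j])[i]).1) [((φ[j])[i]).2]) := by
  have hb := reads_vRest two_pos (reads_clause' φ hj)
  have h := reads_item_code two_pos hb hi
  unfold pLit pLits
  rw [min_eq_left (hi.le.trans (clause_length_le_size φ hj))]
  rw [List.getD_eq_getElem?_getD, List.getElem?_eq_getElem hi] at h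
  simpa [encode_literal] using h

/-- **`pVar` reads the variables.** [cite: AroraBarakCC2009, §2.3] -/
theorem pVar_eq {j : ℕ} (hj : j < φ.length) {i : ℕ} (hi : i < (φ[j]).length) : pVar (sn (encodingCNF.encode φ)) j i = ((φ[j])[i]).1 := by
  unfold pVar; exact vVal_encodeNat (by norm_num) (reads_literal φ hj hi)

/-- **`pPol` reads the polarities.** [cite: AroraBarakCC2009, §2.3] -/
theorem pPol_eq {j : ℕ} (hj : j < φ.length) {i : ℕ} (hi : i < (φ[j]).length) : pPol (sn (encodingCNF.encode φ)) j i = ((φ[j])[i]).2.toNat := by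
  unfold pPol
  have h := reads_vRest (by norm_num) (reads_literal φ hj hi)
  obtain ⟨h1, h2⟩ := h 0 (by simp)
  simp only [mul_zero, add_zero, List.getElem_cons_zero] at h1 h2
  rw [tb_sn h1, h2]

end Correct

end GapPV

end Literature.Computability.Complexity
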